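import Summits.NavierStokesRegularity.NavierStokesRegularity.Theses.AxisymmetricExtremality
import Summits.NavierStokesRegularity.NavierStokesRegularity.Theorems.AxisymmetricExtremalityAxisymmetricKatoGlobalStubSereginLogSwirlOriginStep3KeyEstimate
import Summits.NavierStokesRegularity.NavierStokesRegularity.Theorems.AxisymmetricExtremalityAxisymmetricKatoGlobalStubSereginLogSwirlOriginLemma21LocalCutoff
import HarnessLib

/-!
# Seregin 2022, §2 Step 3: the key estimate with Lemma 2.1 (ii) discharged — the Step-3 output
# `sup_t ∫(ζΓ)² + (ζΦ)²`, `∫∫|∇(ζΓ)|² + |∇(ζΦ)|²` bounded by data of `v` on `supp ∇ζ ∪ {r ≥ r₁}`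
# and the swirl constant `C₁` only — crux stmt-NavierStokesRegularity-15453
# (`AxisymmetricExtremality.AxisymmetricKatoGlobal`), line registered, support for stub `stub_sereginLogSwirlOrigin`

Support file (`--supports stmt-NavierStokesRegularity-15453`; theorems only, everything proved)
toward the registered stub `stub_sereginLogSwirlOrigin` = the named fact
`Literature.Analysis.FluidPDE.seregin2022_logSwirl_regularAtOrigin` (G. Seregin, J. Math. Fluid
Mech. 24 (2022), Paper 27 = arXiv:2201.00153, §2). The sibling file `…Step3KeyEstimate`
(`cutoff_energy_keyEstimate_of_lemma21`) proves the key estimate of Step 3 (arXiv p. 7,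
"`sup_{-1<t<0}∫_𝒞 η⁶(|Γ|² + |Φ|²)dx + ∫_Q (η³|∇Φ|)² + (η³|∇Γ|)² dxdt ≤ C(v,η,r₁)`") for a
classical axisymmetric solution on a slab, taking Lemma 2.1 (ii) as the numeric hypothesis
`∫|∇²(ζv_r/r)|² ≤ c_L ∫|∇(ζΓ)|² + C_L` at every `t ∈ [t₁, t₂]` (full Cartesian Hessian
`Σᵢⱼ(∂ⱼ∂ᵢ(ζ v_r/r))²`, real integrals, `ζ = η³`). The sibling file `…Lemma21LocalCutoff`
(`integral_hessianSq_cutoff_radVelQuot_le_three_mul`) proves Lemma 2.1 (ii) in the localised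
split form `∫|∇²(ζρ)|² ≤ 3∫(∂₂(ζΓ))² + (3∫(∂₂E₁)² + 3∫q_D²)` with the two error functions
`E₁ = ∂₂ζ ρ − q_ζ v₂`, `q_D = radDerivQuot (∇ζ·v)` (`ρ = radVelQuot v = v_r/r`,
`q_ζ = radDerivQuot ζ = (∂ᵣζ)/r`), which live on `supp |∇ζ|` ("`f ≠ 0` only if `|∇η| > 0`. In
the set `supp |∇η|`, functions `v`, `∇v`, and `∇²v` are bounded", arXiv p. 5). This file puts the
two together:

* `radDerivQuot_eq_zero_of_notMem_tsupport_fderiv` — `q_ζ = 0` off `tsupport (∇ζ)` (so the error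
  functions vanish off `supp |∇ζ|`, not only off `supp ζ`);
* `integral_sq_le_of_abs_le_of_ne_zero` — `∫ f² ≤ P²|B(0,2)|` for a continuous `f` vanishing off
  `tsupport g ⊆ B(0,2)` with `|f| ≤ P` wherever `g ≠ 0`;
* `integral_fderiv_sq_le_integral_gradSq` — `∫(∂₂G)² ≤ ∫|∇G|²`;
* `integral_hessianSq_cutoff_radVelQuot_le_of_pointwise` — **Lemma 2.1 (ii) in the numeric form
  consumed by Step 3**, at a fixed time: `∫|∇²(ζρ)|² ≤ 3∫|∇(ζΓ)|² + 3(P₃² + P₄²)V` from the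
  pointwise bounds `|∂₂E₁| ≤ P₃`, `|q_D| ≤ P₄` on `{∇ζ ≠ 0}` and `|B(0,2)| ≤ V`
  (i.e. `c_L = 3`, `C_L = 3(P₃² + P₄²)V`);
* `cutoff_energy_keyEstimate_unconditional` (registered sub-goal) — **the key estimate of Step 3
  with Lemma 2.1 (ii) discharged**: `cutoff_energy_keyEstimate_of_lemma21` with its hypothesis
  `∫|∇²(ζv_r/r)|² ≤ c_L∫|∇(ζΓ)|² + C_L` (and the constants `c_L, C_L`) removed, replaced by the
  two pointwise constants `P₃ ≥ |∂₂(∂₂ζ ρ − q_ζ v₂)|`, `P₄ ≥ |q_{∇ζ·v}|` on `{∇ζ(t,·) ≠ 0}`,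
  `t ∈ [t₁, t₂]` — bounds of `v, ∇v, ∇²v` on `supp ∇η` of the same kind as the existing
  `P₀, P₁, P₂` (the paper's `C(v,η)` of Lemma 2.1: "these terms contain `v₃, v_{r,3}, v_{3,r},
  v_{3,rr}, v_{3,r}/r, v_{r,3r}, v_{r,3}/r`"). The inputs are now exactly: a classical axisymmetric
  solution on the slab `(a, b) ⊇ [t₁, t₂]`, the cut-off `ζ` (jointly smooth, axisymmetric,
  supported in `𝒞`), the swirl bound (2.2) with constant `C₁` on `r < r₁`, pointwise bounds on
  `supp ∇ζ ∪ {r ≥ r₁}` (`M, Bcut, P₀, …, P₄`) and the smallness of `r₁`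
  (`8C₁/ln(e/r₁) + 13C₁/ln²(e/r₁) + 4ε < 2ν`, the case `c_L = 3` of the sibling's
  `8C₁/ln(e/r₁) + C₁(1 + 4c_L)/ln²(e/r₁) + 4ε < 2ν`); nothing about second derivatives of
  `ζv_r/r` remains. Conclusion: with `E(t) = ∫(ζΓ)² + ∫(ζΦ)²`, `L = ln(e/r₁)`,
  `K = E(t₁) + (Bcut + (12C₁(P₃² + P₄²)V/L² + ((P₀² + P₁²)/(2ε) + 2P₂)V) + 4MV)(t₂ − t₁)`:
  `sup_{[t₁,t₂]} E ≤ K` and `∫_{t₁}^{t₂}(∫|∇(ζΓ)|² + ∫|∇(ζΦ)|²) ≤ K/(2ν − 8C₁/L − (13C₁/L² + 4ε))`.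

Regularity bookkeeping: `IsClassicalNSSolutionOn (Ioo a b)` makes every slice `v t` globally
`C^∞` and divergence free and `IsSmoothSpaceTimeOn (Ioo a b) ζ` makes `ζ t` globally `C^∞`, so
the Lemma's hypotheses (`ζ, v ∈ C⁵` globally, `div v = 0` on `tsupport ζ`, `ζ` compactly
supported — `tsupport ζ ⊆ 𝒞 ⊆ B̄(0,2)`) hold at every `t ∈ [t₁, t₂] ⊆ (a, b)`; no bump
globalisation is needed at this level (it belongs to Step 1, with the cut-off).

What then remains of the named fact: the derivation of `M, Bcut, P₀, …, P₄` from sup-norm bounds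
of `v, ∇v, ∇²v, ∇ω` on `supp ∇η ∪ {r ≥ r₁}` for the specific product cut-off of Step 1, Step 1
itself (first singular time, cut-off adapted to partial regularity, suitable weak → classical on
the clean slab) and the Step-4 assembly `C(R) → 0` (`…Step4AssemblyPoloidal`, `…VThetaPassage`,
`…Step4Endgame`).

## Mathlib / tree search

Tree: `cutoff_energy_keyEstimate_of_lemma21` (`…Step3KeyEstimate`),
`integral_hessianSq_cutoff_radVelQuot_le_three_mul` (`…Lemma21LocalCutoff`),
`radDerivQuot_eq_zero_of_notMem_tsupport`, `eq_zero_of_forall_apply_zero_ne` (`…CFZBounds`),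
`fderiv_eq_zero_of_forall_notMem` (`…CutoffDivCurl`), `hasCompactSupport_of_eq_zero`,
`continuous_fderiv_apply_of_contDiff` (`…Step3CutoffCalculus`), `spaceCyl_subset_closedBall`
(`…LerayLogHardy`), `mul_radDerivQuot_eq_fderiv_zero`, `continuous_radDerivQuot`,
`IsAxisymmetricScalar.fderiv_rotZ_apply_rotZ` (`AxisymRadialQuotient`). Mathlib:
`norm_setIntegral_le_of_norm_le_const`, `setIntegral_eq_integral_of_forall_compl_eq_zero`,
`tsupport_fderiv_subset`, `closure_minimal`, `isClosed_le`, `sq_le_sq'`.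
`lean search 'keyEstimate' --decl`: only `cutoff_energy_keyEstimate(_of_lemma21)` in this
namespace; `lean search 'notMem_tsupport_fderiv|keyEstimate_unconditional'`: no matches
(2026-08-17).

## References

* G. Seregin, J. Math. Fluid Mech. 24 (2022), Paper No. 27 = arXiv:2201.00153, §2, Lemma 2.1
  (arXiv p. 5) and Step 3 (arXiv pp. 6–7, the key estimate). [`Seregin2022LocalAxisym`]
-/

noncomputable section

open MeasureTheory Set Filter Topology Function Metric intervalIntegral
open scoped ENNReal ContDiff
open Literature.Analysis.FluidPDE

-- `<Problem> = <Summit>` duplicates a namespace component by design (lakefile sets the same option).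
set_option linter.dupNamespace false

namespace Summit.NavierStokesRegularity.NavierStokesRegularity.Theorems.AxisymmetricKatoGlobal.EulerScaling

/-! ### Error functions vanish off `supp |∇ζ|`; pointwise bounds integrate over `B̄(0,2)` -/

section Tools

variable {S : EuclideanSpace ℝ (Fin 3) → ℝ}

/-- **`(∂ᵣS)/r` vanishes off the support of `∇S`**: for an axisymmetric scalar `S ∈ C²` and
`y ∉ tsupport (∇S)`, `radDerivQuot S y = 0` (off `{x₀ = 0}` it is `∂₀S/x₀` with `∂₀S = DS e₀ = 0`
there, and density; `S` itself need not vanish near `y`). [folklore] -/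
theorem radDerivQuot_eq_zero_of_notMem_tsupport_fderiv (hS : ContDiff ℝ 2 S)
    (hax : IsAxisymmetricScalar S) {y : EuclideanSpace ℝ (Fin 3)}
    (hy : y ∉ tsupport (fderiv ℝ S)) : radDerivQuot S y = 0 := by
  refine eq_zero_of_forall_apply_zero_ne (continuous_radDerivQuot hS)
    (isClosed_tsupport (fderiv ℝ S)).isOpen_compl (fun z hz hz0 => ?_) hy
  have h := mul_radDerivQuot_eq_fderiv_zero hS hax z
  rw [image_eq_zero_of_notMem_tsupport hz] at h
  simpa [hz0] using h

/-- **A pointwise bound on `{g ≠ 0}` integrates over `B̄(0,2)`**: if `f` is continuous, vanishes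
off `tsupport g ⊆ B̄(0,2)` and `|f| ≤ P` wherever `g ≠ 0`, then `|f| ≤ P` on `tsupport g` by
continuity and `∫ f² ≤ P² |B̄(0,2)|`. [folklore] -/
theorem integral_sq_le_of_abs_le_of_ne_zero {F : Type*} [Zero F]
    {g : EuclideanSpace ℝ (Fin 3) → F} {f : EuclideanSpace ℝ (Fin 3) → ℝ} {P : ℝ}
    (hf : Continuous f) (hg : tsupport g ⊆ closedBall (0 : EuclideanSpace ℝ (Fin 3)) 2)
    (h0 : ∀ x ∉ tsupport g, f x = 0) (hP : ∀ x, g x ≠ 0 → |f x| ≤ P) :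
    ∫ x, f x ^ 2 ≤ P ^ 2 * volume.real (closedBall (0 : EuclideanSpace ℝ (Fin 3)) 2) := by
  have hcl : IsClosed {y | |f y| ≤ P} := isClosed_le (continuous_abs.comp hf) continuous_const
  have h1 : ∀ x ∈ tsupport g, |f x| ≤ P := fun x hx =>
    (closure_minimal (t := {y | |f y| ≤ P}) (fun y hy => hP y (mem_support.1 hy)) hcl) hx
  have h2 : ∀ x, f x ^ 2 ≤ P ^ 2 := fun x => by
    by_cases hx : x ∈ tsupport g
    · obtain ⟨hl, hr⟩ := abs_le.1 (h1 x hx)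
      exact sq_le_sq' hl hr
    · rw [h0 x hx]
      simpa using sq_nonneg P
  have h3 : ∫ x in closedBall (0 : EuclideanSpace ℝ (Fin 3)) 2, f x ^ 2 = ∫ x, f x ^ 2 :=
    setIntegral_eq_integral_of_forall_compl_eq_zero fun x hx => by
      rw [h0 x fun h => hx (hg h)]
      simp
  have h4 := norm_setIntegral_le_of_norm_le_const (μ := volume) (s := closedBall (0 : EuclideanSpace ℝ (Fin 3)) 2)
    (f := fun x => f x ^ 2) measure_closedBall_lt_top fun x _ => (show ‖f x ^ 2‖ ≤ P ^ 2 by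
      rw [Real.norm_eq_abs, abs_of_nonneg (sq_nonneg _)]; exact h2 x)
  rw [← h3]
  rw [Real.norm_eq_abs] at h4
  exact (le_abs_self _).trans h4

/-- `∫(∂₂G)² ≤ ∫|∇G|²` for `G ∈ C¹` with compact support (all three squares are integrable).
[folklore] -/
theorem integral_fderiv_sq_le_integral_gradSq {G : EuclideanSpace ℝ (Fin 3) → ℝ}
    (hG : ContDiff ℝ 1 G) (hGc : HasCompactSupport G) :
    ∫ x, fderiv ℝ G x (EuclideanSpace.single 2 1) ^ 2 ≤
      ∫ x, (fderiv ℝ G x (EuclideanSpace.single 0 1) ^ 2 + fderiv ℝ G x (EuclideanSpace.single 1 1) ^ 2 +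
        fderiv ℝ G x (EuclideanSpace.single 2 1) ^ 2) := by
  have hi : ∀ i : Fin 3, Integrable fun x => fderiv ℝ G x (EuclideanSpace.single i 1) ^ 2 := fun i =>
    ((continuous_fderiv_apply_of_contDiff hG _).pow 2).integrable_of_hasCompactSupport
      (hasCompactSupport_of_eq_zero (hGc.fderiv_apply ℝ (EuclideanSpace.single i 1))
        fun x hx => by simp [hx])
  refine integral_mono (hi 2) (((hi 0).add (hi 1)).add (hi 2)) fun x => ?_
  dsimp only
  nlinarith [sq_nonneg (fderiv ℝ G x (EuclideanSpace.single 0 1)),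
    sq_nonneg (fderiv ℝ G x (EuclideanSpace.single 1 1))]

end Tools

/-! ### Lemma 2.1 (ii) in the numeric form consumed by Step 3 -/

section Lemma21Numeric

variable {ζ : EuclideanSpace ℝ (Fin 3) → ℝ} {v : EuclideanSpace ℝ (Fin 3) → EuclideanSpace ℝ (Fin 3)}

/-- **Seregin 2022, Lemma 2.1 (ii), numeric form `∫|∇²(ζv_r/r)|² ≤ c_L∫|∇(ζΓ)|² + C_L` with
`c_L = 3`, `C_L = 3(P₃² + P₄²)V`.** For an axisymmetric scalar `ζ ∈ C⁵` supported in `𝒞`, an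
axisymmetric `v ∈ C⁵` with `div v = 0` on `tsupport ζ`, pointwise bounds
`|∂₂(∂₂ζ ρ − q_ζ v₂)| ≤ P₃`, `|q_{∇ζ·v}| ≤ P₄` on `{∇ζ ≠ 0}` (`ρ = v_r/r`, `q = (∂ᵣ·)/r`; the
paper's `C(v,η)`: "`f ≠ 0` only if `|∇η| > 0` … `v, ∇v, ∇²v` are bounded") and `|B̄(0,2)| ≤ V`:
`∫ Σᵢⱼ(∂ⱼ∂ᵢ(ζρ))² ≤ 3∫|∇(ζΓ)|² + 3(P₃² + P₄²)V` (`Γ = ω_θ/r = angVortQuot v`). From the split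
form `integral_hessianSq_cutoff_radVelQuot_le_three_mul`, `(∂₂(ζΓ))² ≤ |∇(ζΓ)|²`, and the
vanishing of both error functions off `tsupport (∇ζ) ⊆ B̄(0,2)`. [cite: Seregin2022LocalAxisym, §2 Lemma 2.1, second estimate (arXiv:2201.00153 p. 5)] -/
theorem integral_hessianSq_cutoff_radVelQuot_le_of_pointwise (hζ : ContDiff ℝ 5 ζ)
    (hζax : IsAxisymmetricScalar ζ) (hζs : tsupport ζ ⊆ SereginSverak2009.spaceCyl 0 1)
    (hv : ContDiff ℝ 5 v) (hvax : IsAxisymmetric v)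
    (hdiv : ∀ y ∈ tsupport ζ, VectorCalculus.divergence v y = 0) {P₃ P₄ V : ℝ}
    (hV : volume.real (closedBall (0 : EuclideanSpace ℝ (Fin 3)) 2) ≤ V)
    (hP3 : ∀ x, fderiv ℝ ζ x ≠ 0 → |fderiv ℝ (fun y => fderiv ℝ ζ y (EuclideanSpace.single 2 1) *
      radVelQuot v y - radDerivQuot ζ y * v y 2) x (EuclideanSpace.single 2 1)| ≤ P₃)
    (hP4 : ∀ x, fderiv ℝ ζ x ≠ 0 → |radDerivQuot (fun y => fderiv ℝ ζ y (v y)) x| ≤ P₄) :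
    ∫ x, ∑ i : Fin 3, ∑ j : Fin 3, (fderiv ℝ (fun y =>
        fderiv ℝ (fun y => ζ y * radVelQuot v y) y (EuclideanSpace.single i 1)) x
          (EuclideanSpace.single j 1)) ^ 2 ≤
      3 * (∫ x, (fderiv ℝ (fun y => ζ y * angVortQuot v y) x (EuclideanSpace.single 0 1) ^ 2 +
          fderiv ℝ (fun y => ζ y * angVortQuot v y) x (EuclideanSpace.single 1 1) ^ 2 +
          fderiv ℝ (fun y => ζ y * angVortQuot v y) x (EuclideanSpace.single 2 1) ^ 2)) +
        3 * (P₃ ^ 2 + P₄ ^ 2) * V := by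
  have hB : tsupport ζ ⊆ closedBall (0 : EuclideanSpace ℝ (Fin 3)) 2 :=
    hζs.trans spaceCyl_subset_closedBall
  have hζc : HasCompactSupport ζ :=
    IsCompact.of_isClosed_subset (isCompact_closedBall _ _) (isClosed_tsupport ζ) hB
  have hζ2 : ContDiff ℝ 2 ζ := hζ.of_le (by norm_num)
  have h := integral_hessianSq_cutoff_radVelQuot_le_three_mul hζ hζc hζax hv hvax hdiv
  -- (a) the leading term: `∫(∂₂(ζΓ))² ≤ ∫|∇(ζΓ)|²`
  have hG1 : ContDiff ℝ 1 fun y => ζ y * angVortQuot v y := (hζ.of_le (by norm_num)).mul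
    (contDiff_angVortQuot (n := 1) (by exact_mod_cast hv.of_le (by norm_num)))
  have hGc : HasCompactSupport fun y => ζ y * angVortQuot v y := hζc.mul_right
  have ha := integral_fderiv_sq_le_integral_gradSq hG1 hGc
  -- (b) the two error functions are continuous and vanish off `T = tsupport (∇ζ) ⊆ B̄(0,2)`
  have hT : tsupport (fderiv ℝ ζ) ⊆ closedBall (0 : EuclideanSpace ℝ (Fin 3)) 2 :=
    (tsupport_fderiv_subset ℝ).trans hB
  have hB1 : ContDiff ℝ 1 fun y => fderiv ℝ ζ y (EuclideanSpace.single 2 1) * radVelQuot v y -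
      radDerivQuot ζ y * v y 2 :=
    (((hζ.fderiv_right (m := 1) (by norm_num)).clm_apply contDiff_const).mul
      (contDiff_radVelQuot (n := 1) (by exact_mod_cast hv.of_le (by norm_num)))).sub
      ((contDiff_radDerivQuot (n := 1) (by exact_mod_cast hζ.of_le (by norm_num))).mul
        ((contDiff_piLp_apply (𝕜 := ℝ) (p := 2) (n := 1) (i := (2 : Fin 3))).comp
          (hv.of_le (by norm_num))))
  have hD2 : ContDiff ℝ 2 fun y => fderiv ℝ ζ y (v y) :=
    (hζ.fderiv_right (m := 2) (by norm_num)).clm_apply (hv.of_le (by norm_num))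
  have hDax : IsAxisymmetricScalar fun y => fderiv ℝ ζ y (v y) := fun θ y => by
    simp only [hvax θ y]
    exact hζax.fderiv_rotZ_apply_rotZ (hζ.differentiable (by norm_num)) θ y (v y)
  have hcB : Continuous fun x => fderiv ℝ (fun y => fderiv ℝ ζ y (EuclideanSpace.single 2 1) *
      radVelQuot v y - radDerivQuot ζ y * v y 2) x (EuclideanSpace.single 2 1) :=
    (hB1.continuous_fderiv one_ne_zero).clm_apply continuous_const
  have hcD : Continuous (radDerivQuot fun y => fderiv ℝ ζ y (v y)) := continuous_radDerivQuot hD2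
  have h0E : ∀ y ∉ tsupport (fderiv ℝ ζ), fderiv ℝ ζ y (EuclideanSpace.single 2 1) *
      radVelQuot v y - radDerivQuot ζ y * v y 2 = 0 := fun y hy => by
    rw [image_eq_zero_of_notMem_tsupport hy,
      radDerivQuot_eq_zero_of_notMem_tsupport_fderiv hζ2 hζax hy]
    simp
  have h0B : ∀ x ∉ tsupport (fderiv ℝ ζ), fderiv ℝ (fun y =>
      fderiv ℝ ζ y (EuclideanSpace.single 2 1) * radVelQuot v y - radDerivQuot ζ y * v y 2) x
      (EuclideanSpace.single 2 1) = 0 := fun x hx => by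
    rw [fderiv_eq_zero_of_forall_notMem (isClosed_tsupport _) h0E hx]
    rfl
  have h0D' : ∀ y ∉ tsupport (fderiv ℝ ζ), fderiv ℝ ζ y (v y) = 0 := fun y hy => by
    rw [image_eq_zero_of_notMem_tsupport hy]
    rfl
  have hDsub : tsupport (fun y => fderiv ℝ ζ y (v y)) ⊆ tsupport (fderiv ℝ ζ) :=
    closure_minimal (fun y hy => by_contra fun h' => hy (h0D' y h')) (isClosed_tsupport _)
  have h0D : ∀ x ∉ tsupport (fderiv ℝ ζ), radDerivQuot (fun y => fderiv ℝ ζ y (v y)) x = 0 :=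
    fun x hx => radDerivQuot_eq_zero_of_notMem_tsupport hD2 hDax fun h' => hx (hDsub h')
  have hb := integral_sq_le_of_abs_le_of_ne_zero hcB hT h0B hP3
  have hc := integral_sq_le_of_abs_le_of_ne_zero hcD hT h0D hP4
  -- (c) assemble
  have hPV : (P₃ ^ 2 + P₄ ^ 2) * volume.real (closedBall (0 : EuclideanSpace ℝ (Fin 3)) 2) ≤
      (P₃ ^ 2 + P₄ ^ 2) * V := mul_le_mul_of_nonneg_left hV (by positivity)
  linarith

end Lemma21Numeric

/-! ### The key estimate of Step 3, unconditional -/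

/-- **Seregin 2022, §2 Step 3, the key estimate with Lemma 2.1 (ii) discharged** (arXiv p. 7:
"`sup_{-1<t<0}∫_𝒞 η⁶(|Γ|² + |Φ|²)dx + ∫_Q (η³|∇Φ|)² + (η³|∇Γ|)² dxdt ≤ C(v,η,r₁)`"), for a
classical axisymmetric solution on a slab: `cutoff_energy_keyEstimate_of_lemma21` with the
numeric Lemma-2.1 (ii) hypothesis replaced by `integral_hessianSq_cutoff_radVelQuot_le_of_pointwise`
(`c_L = 3`, `C_L = 3(P₃² + P₄²)V`), i.e. by the two pointwise constants `P₃ ≥ |∂₂(∂₂ζ ρ − q_ζ v₂)|`,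
`P₄ ≥ |q_{∇ζ·v}|` on `{∇ζ(t,·) ≠ 0}`, `t ∈ [t₁, t₂]` (bounds of `v, ∇v, ∇²v` on `supp ∇η`, the
paper's `C(v,η)`), next to the existing `M, Bcut, P₀, P₁, P₂`, (2.2) with constant `C₁` and the
smallness `8C₁/ln(e/r₁) + 13C₁/ln²(e/r₁) + 4ε < 2ν`. See the module docstring for the constants.
Registered sub-goal toward `stub_sereginLogSwirlOrigin`. [cite: Seregin2022LocalAxisym, §2 Step 3 (arXiv:2201.00153 p. 7, the key estimate) and Lemma 2.1 (p. 5)] -/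
theorem cutoff_energy_keyEstimate_unconditional : ∀ (a b ν : ℝ) (v : ℝ → EuclideanSpace ℝ (Fin 3) → EuclideanSpace ℝ (Fin 3)) (q : ℝ → EuclideanSpace ℝ (Fin 3) → ℝ) (ζ : ℝ → EuclideanSpace ℝ (Fin 3) → ℝ) (t₁ t₂ C₁ r₁ M Bcut ε P₀ P₁ P₂ P₃ P₄ V : ℝ), IsClassicalNSSolutionOn (Ioo a b) ν 0 v q → (∀ s ∈ Ioo a b, IsAxisymmetric (v s)) → 0 ≤ ν → IsSmoothSpaceTimeOn (Ioo a b) ζ → (∀ s ∈ Ioo a b, IsAxisymmetricScalar (ζ s)) → (∀ s ∈ Ioo a b, tsupport (ζ s) ⊆ SereginSverak2009.spaceCyl 0 1) → Icc t₁ t₂ ⊆ Ioo a b → t₁ ≤ t₂ → 0 ≤ C₁ → 0 < r₁ → r₁ < 1 → 0 ≤ M → 0 ≤ Bcut → 0 < ε → 0 ≤ P₂ → volume.real (closedBall (0 : EuclideanSpace ℝ (Fin 3)) 2) ≤ V → (∀ t ∈ Icc t₁ t₂, ∀ x, 0 < cylRadius x → cylRadius x < r₁ → |swirl (v t) x| ≤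 C₁ / Real.log (Real.exp 1 / cylRadius x) ^ 3) → (∀ t ∈ Icc t₁ t₂, ∀ x, r₁ ≤ cylRadius x → |angVelQuot (v t) x * (ζ t x * angVortQuot (v t) x) * (ζ t x * radVelQuot (curl (v t)) x)| ≤ M) → (∀ t ∈ Icc t₁ t₂, (2 * (∫ x, ζ t x * timeDerivWithin (Ioo a b) ζ t x * angVortQuot (v t) x ^ 2) + 2 * (∫ x, ζ t x * angVortQuot (v t) x ^ 2 * fderiv ℝ (ζ t) x (v t x)) + 2 * ν * (∫ x, angVortQuot (v t) x ^ 2 * (fderiv ℝ (ζ t) x (EuclideanSpace.single 0 1) ^ 2 + fderiv ℝ (ζ t) x (EuclideanSpace.single 1 1) ^ 2 + fderiv ℝ (ζ t) x (EuclideanSpace.single 2 1) ^ 2)) - 4 * ν * (∫ x, ζ t x * angVortQuot (v t) x ^ 2 * radDerivQuot (ζ t) x)) + (2 * (∫ x, ζ t x * timeDerivWithin (Ioo a b) ζ t x * radVelQuot (curl (v t)) x ^ 2) + 2 * (∫ x, ζ t x * radVelQuot (curl (v t)) x ^ 2 * fderiv ℝ (ζ t) x (v t x)) + 2 * ν * (∫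 x, radVelQuot (curl (v t)) x ^ 2 * (fderiv ℝ (ζ t) x (EuclideanSpace.single 0 1) ^ 2 + fderiv ℝ (ζ t) x (EuclideanSpace.single 1 1) ^ 2 + fderiv ℝ (ζ t) x (EuclideanSpace.single 2 1) ^ 2)) - 4 * ν * (∫ x, ζ t x * radVelQuot (curl (v t)) x ^ 2 * radDerivQuot (ζ t) x)) ≤ Bcut) → (∀ t ∈ Icc t₁ t₂, ∀ x, r₁ ≤ cylRadius x → |swirlVelocity (v t) x| * ‖fderiv ℝ (fun y => ζ t y * radVelQuot (v t) y) x‖ ≤ P₀) → (∀ t ∈ Icc t₁ t₂, ∀ x, |radVelQuot (v t) x| * |swirlVelocity (v t) x| * ‖fderiv ℝ (ζ t) x‖ ≤ P₁) → (∀ t ∈ Icc t₁ t₂, ∀ x, |ζ t x * radVelQuot (curl (v t)) x| * |swirlVelocity (v t) x| * (‖fderiv ℝ (ζ t) x‖ * ‖fderiv ℝ (radVelQuot (v t)) x‖) ≤ P₂) → (∀ t ∈ Icc t₁ t₂, ∀ x, fderiv ℝ (ζ t) x ≠ 0 → |fderiv ℝ (fun y => fderiv ℝ (ζ t) y (EuclideanSpace.single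 2 1) * radVelQuot (v t) y - radDerivQuot (ζ t) y * v t y 2) x (EuclideanSpace.single 2 1)| ≤ P₃) → (∀ t ∈ Icc t₁ t₂, ∀ x, fderiv ℝ (ζ t) x ≠ 0 → |radDerivQuot (fun y => fderiv ℝ (ζ t) y (v t y)) x| ≤ P₄) → 8 * C₁ / Real.log (Real.exp 1 / r₁) + (13 * C₁ / Real.log (Real.exp 1 / r₁) ^ 2 + 4 * ε) < 2 * ν → (∀ t ∈ Icc t₁ t₂, (∫ x, (ζ t x * angVortQuot (v t) x) ^ 2) + (∫ x, (ζ t x * radVelQuot (curl (v t)) x) ^ 2) ≤ (∫ x, (ζ t₁ x * angVortQuot (v t₁) x) ^ 2) + (∫ x, (ζ t₁ x * radVelQuot (curl (v t₁)) x) ^ 2) + (Bcut + (12 * C₁ * (P₃ ^ 2 + P₄ ^ 2) * V / Real.log (Real.exp 1 / r₁) ^ 2 + ((P₀ ^ 2 + P₁ ^ 2) / (2 * ε) + 2 * P₂) * V) + 4 * M * V) * (t₂ - t₁)) ∧ ∫ s in t₁..t₂, ((∫ x, (fderiv ℝ (fun y => ζ s y * angVortQuot (v s) y) x (EuclideanSpace.single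 0 1) ^ 2 + fderiv ℝ (fun y => ζ s y * angVortQuot (v s) y) x (EuclideanSpace.single 1 1) ^ 2 + fderiv ℝ (fun y => ζ s y * angVortQuot (v s) y) x (EuclideanSpace.single 2 1) ^ 2)) + (∫ x, (fderiv ℝ (fun y => ζ s y * radVelQuot (curl (v s)) y) x (EuclideanSpace.single 0 1) ^ 2 + fderiv ℝ (fun y => ζ s y * radVelQuot (curl (v s)) y) x (EuclideanSpace.single 1 1) ^ 2 + fderiv ℝ (fun y => ζ s y * radVelQuot (curl (v s)) y) x (EuclideanSpace.single 2 1) ^ 2))) ≤ ((∫ x, (ζ t₁ x * angVortQuot (v t₁) x) ^ 2) + (∫ x, (ζ t₁ x * radVelQuot (curl (v t₁)) x) ^ 2) + (Bcut + (12 * C₁ * (P₃ ^ 2 + P₄ ^ 2) * V / Real.log (Real.exp 1 / r₁) ^ 2 + ((P₀ ^ 2 + P₁ ^ 2) / (2 * ε) + 2 * P₂) * V) + 4 * M * V) * (t₂ - t₁)) / (2 * ν - 8 * C₁ / Real.log (Real.exp 1 / r₁) - (13 * C₁ / Real.log (Real.exp 1 / r₁) ^ 2 + 4 * ε)) := by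
  intro a b ν v q ζ t₁ t₂ C₁ r₁ M Bcut ε P₀ P₁ P₂ P₃ P₄ V hns hax hν hζ hζax hζs hsub h12 hC₁ hr₁ hr₁1 hM hBcut hε hP₂ hV hσ hfar hcut hP0 hP1 hP2 hP3 hP4 hsmall
  have hVOL : 0 ≤ volume.real (closedBall (0 : EuclideanSpace ℝ (Fin 3)) 2) := measureReal_nonneg
  have hV0 : 0 ≤ V := hVOL.trans hV
  have hCL : 0 ≤ 3 * (P₃ ^ 2 + P₄ ^ 2) * V := mul_nonneg (by positivity) hV0
  -- Lemma 2.1 (ii), numeric form, at every `t ∈ [t₁, t₂]`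
  have hL21 : ∀ t ∈ Icc t₁ t₂, (∫ x, ∑ i : Fin 3, ∑ j : Fin 3, (fderiv ℝ (fun y => fderiv ℝ (fun y => ζ t y * radVelQuot (v t) y) y (EuclideanSpace.single i 1)) x (EuclideanSpace.single j 1)) ^ 2) ≤ 3 * (∫ x, (fderiv ℝ (fun y => ζ t y * angVortQuot (v t) y) x (EuclideanSpace.single 0 1) ^ 2 + fderiv ℝ (fun y => ζ t y * angVortQuot (v t) y) x (EuclideanSpace.single 1 1) ^ 2 + fderiv ℝ (fun y => ζ t y * angVortQuot (v t) y) x (EuclideanSpace.single 2 1) ^ 2)) + 3 * (P₃ ^ 2 + P₄ ^ 2) * V := by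
    intro t ht
    have hts : t ∈ Ioo a b := hsub ht
    have hv5 : ContDiff ℝ 5 (v t) := (hns.contDiff_velocity hts).of_le (by norm_cast)
    have hζ5 : ContDiff ℝ 5 (ζ t) := (hζ.contDiff_slice hts).of_le (by norm_cast)
    exact integral_hessianSq_cutoff_radVelQuot_le_of_pointwise hζ5 (hζax t hts) (hζs t hts) hv5
      (hax t hts) (fun y _ => hns.divFree t hts y) hV (hP3 t ht) (hP4 t ht)
  have hsmall' : 8 * C₁ / Real.log (Real.exp 1 / r₁) + (C₁ * (1 + 4 * 3) / Real.log (Real.exp 1 / r₁) ^ 2 + 4 * ε) < 2 * ν := by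
    have e : C₁ * (1 + 4 * 3) = 13 * C₁ := by ring
    rw [e]; exact hsmall
  obtain ⟨hsup, hdiss⟩ := cutoff_energy_keyEstimate_of_lemma21 a b ν v q ζ t₁ t₂ C₁ r₁ M Bcut ε P₀ P₁ P₂ 3 (3 * (P₃ ^ 2 + P₄ ^ 2) * V) V
    hns hax hν hζ hζax hζs hsub h12 hC₁ hr₁ hr₁1 hM hBcut hε hP₂ (by norm_num) hCL hV hσ hfar hcut hP0 hP1 hP2 hL21 hsmall'
  have e1 : C₁ * (1 + 4 * 3) = 13 * C₁ := by ring
  have e2 : 4 * C₁ * (3 * (P₃ ^ 2 + P₄ ^ 2) * V) = 12 * C₁ * (P₃ ^ 2 + P₄ ^ 2) * V := by ring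
  simp only [e1, e2] at hsup hdiss
  exact ⟨hsup, hdiss⟩

end Summit.NavierStokesRegularity.NavierStokesRegularity.Theorems.AxisymmetricKatoGlobal.EulerScaling

end
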